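import Mathlib
import Summits.NavierStokesRegularity.NavierStokesRegularity.Theses.PerpetualPump

/-!
# Sketch (ideator 3, crux-ideate round 1) — crux `PerpetualPump.CircuitTrace` (stmt-NavierStokesRegularity-1836)

First-lemma signatures for the two idea cards

* `clock-discounted-trail-mass`  — `TraceInequality`, `LateActivitySparse`
* `quiet-valve-budget`           — `TriadFlux`, `ValveBudget`, `QuietBlockRegular`

and the intended composition `LineCloses` (pure logic + a choice of `K`, `n`; NOT a skeleton —
crux-plan's job).  Everything is Mathlib-only; the circuit right-hand side is copied verbatim from
the crux.  Notation (docstrings): `a_{i,n}(t) := lam^{n/5} X_{i,n}(t)` is the scale-invariant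
("critical") amplitude; the clock of scale `n` runs at rate `lam^{4n/5}`.
-/

noncomputable section

namespace Summit.NavierStokesRegularity.NavierStokesRegularity.Cruxes.CircuitTrace.Ideator3

open Finset

/-- Tao circuit right-hand side ((4.3) with α = 2/5, offsets S = {0,e₁,e₂,e₃}), verbatim the
`let F` of `PerpetualPump.CircuitTrace`. -/
def circuitRHS (lam : ℝ) (m : ℕ) (coeff : Fin m → Fin m → Fin m → Option (Fin 3) → ℝ)
    (X : Fin m → ℤ → ℝ → ℝ) (i : Fin m) (n : ℤ) (t : ℝ) : ℝ :=
  -(lam ^ ((4 / 5 : ℝ) * n)) * X i n t +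
    ∑ i₁ : Fin m, ∑ i₂ : Fin m, ∑ μ : Option (Fin 3),
      coeff i₁ i₂ i μ * lam ^ ((n : ℝ) - (if μ = some 2 then 1 else 0)) *
        X i₁ (n + ((if μ = some 0 then 1 else 0) - (if μ = some 2 then 1 else 0))) t *
        X i₂ (n + ((if μ = some 1 then 1 else 0) - (if μ = some 2 then 1 else 0))) t

/-- Tao's symmetry (4.2). -/
def IsSymmCoeff (m : ℕ) (coeff : Fin m → Fin m → Fin m → Option (Fin 3) → ℝ) : Prop :=
  ∀ (i₁ i₂ i₃ : Fin m) (μ : Option (Fin 3)),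
    coeff i₁ i₂ i₃ μ = coeff i₂ i₁ i₃ (Option.map (Equiv.swap (0 : Fin 3) 1) μ)

/-- Cyclic cancellation (energy conservation of the nonlinearity, triad by triad). -/
def IsCyclicCoeff (m : ℕ) (coeff : Fin m → Fin m → Fin m → Option (Fin 3) → ℝ) : Prop :=
  ∀ (v : Fin 3 → Fin m) (μ : Option (Fin 3)),
    ∑ σ : Equiv.Perm (Fin 3), coeff (v (σ 0)) (v (σ 1)) (v (σ 2)) (Option.map σ.symm μ) = 0

/-- The solution hypotheses of the crux on `[0,T)`: continuity on `[0,T)`, the ODE on `(0,T)`,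
no modes below `n = 0`, a-priori `H¹⁰` bound (`lam^{4n} = N_n^{10}`) on compact sub-intervals. -/
structure IsCircuitSolution (lam : ℝ) (m : ℕ)
    (coeff : Fin m → Fin m → Fin m → Option (Fin 3) → ℝ) (T : ℝ) (X : Fin m → ℤ → ℝ → ℝ) :
    Prop where
  cont : ∀ (i : Fin m) (n : ℤ), ContinuousOn (X i n) (Set.Ico 0 T)
  ode : ∀ (i : Fin m) (n : ℤ), ∀ t ∈ Set.Ioo 0 T,
    HasDerivAt (X i n) (circuitRHS lam m coeff X i n t) t
  vanish : ∀ (i : Fin m) (n : ℤ) (t : ℝ), n < 0 → X i n t = 0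
  apriori : ∀ T' ∈ Set.Ioo 0 T, ∃ C : ℝ, ∀ (i : Fin m) (n : ℤ), ∀ t ∈ Set.Icc 0 T',
    lam ^ ((4 : ℝ) * n) * |X i n t| ≤ C

/-- Critical (scale-invariant) amplitude `a_{i,n}(t) = lam^{n/5} X_{i,n}(t)`. -/
def critAmp {m : ℕ} (lam : ℝ) (X : Fin m → ℤ → ℝ → ℝ) (i : Fin m) (n : ℤ) (t : ℝ) : ℝ :=
  lam ^ ((1 / 5 : ℝ) * n) * X i n t

/-- The crux's bounded `ℓ³`-in-scale critical norm, `sup_t Σ_{n,i} |a_{i,n}(t)|³ ≤ M`. -/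
def CritL3Bound (lam : ℝ) (m : ℕ) (T M : ℝ) (X : Fin m → ℤ → ℝ → ℝ) : Prop :=
  ∀ t ∈ Set.Ico 0 T, ∀ s : Finset ℤ,
    ∑ n ∈ s, ∑ i : Fin m, (lam ^ ((1 / 5 : ℝ) * n) * |X i n t|) ^ 3 ≤ M

/-! ## Card `clock-discounted-trail-mass` -/

/-- CLOCK-DISCOUNTED TRAIL MASS below scale `j`:
`H_j(t) = Σ_{n=0}^{j} Σ_i lam^{θ(n-j)} |a_{i,n}(t)|³` — a FINITE sum (no modes below 0). -/
def trailMass {m : ℕ} (lam θ : ℝ) (X : Fin m → ℤ → ℝ → ℝ) (j : ℕ) (t : ℝ) : ℝ :=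
  ∑ n ∈ Finset.range (j + 1), ∑ i : Fin m,
    lam ^ (θ * ((n : ℝ) - j)) * |critAmp lam X i (n : ℤ) t| ^ 3

/-- FIRST LEMMA (T): the TRACE INEQUALITY / half-line backward Grönwall.  Because every monomial of
`Ẋ_{i,n}` carries a factor `X_{·,n'}` with `n' ≤ n` (offsets in S: the subspace `{X_{≤ n} = 0}` is
forward-invariant) and the clocks on the half-line `n ≤ j` are `≤ lam^{4j/5}`, the discounted trail
mass decays NO FASTER than the clock of scale `j`: `H_j(t) ≥ e^{-L·lam^{4j/5}(t-s)} H_j(s)`.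
`L` depends on `lam, θ, m, coeff, M` only (through `sup |a| ≤ M^{1/3}`); symmetry, cancellation
and the a-priori bound are NOT used. -/
def TraceInequality : Prop :=
  ∀ lam : ℝ, 1 < lam → ∀ θ : ℝ, 0 < θ →
    ∀ (m : ℕ) (coeff : Fin m → Fin m → Fin m → Option (Fin 3) → ℝ) (M : ℝ),
      ∃ L : ℝ, 0 < L ∧ ∀ (T : ℝ) (X : Fin m → ℤ → ℝ → ℝ), 0 < T →
        IsCircuitSolution lam m coeff T X → CritL3Bound lam m T M X →
          ∀ (j : ℕ) (s t : ℝ), 0 < s → s ≤ t → t < T →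
            Real.exp (-(L * lam ^ ((4 / 5 : ℝ) * j) * (t - s))) * trailMass lam θ X j s
              ≤ trailMass lam θ X j t

/-- COROLLARY (late activity is sparse): the number of scales `j` carrying a `δ`-exceedance within
`K` units of THEIR OWN clock before `T` is bounded by `N = N(lam, m, coeff, M, δ, K)`,
independently of `T` and of the solution — each exceedance deposits `≥ e^{-LK} δ³` of discounted
trail mass for ever, and the deposits of distinct scales add up inside
`‖a(t)‖³_{ℓ³}/(1 - lam^{-θ}) ≤ M/(1 - lam^{-θ})`. -/
def LateActivitySparse : Prop :=
  ∀ lam : ℝ, 1 < lam →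
    ∀ (m : ℕ) (coeff : Fin m → Fin m → Fin m → Option (Fin 3) → ℝ) (M δ K : ℝ), 0 < δ → 0 ≤ K →
      ∃ N : ℕ, ∀ (T : ℝ) (X : Fin m → ℤ → ℝ → ℝ), 0 < T →
        IsCircuitSolution lam m coeff T X → CritL3Bound lam m T M X →
          ∀ S : Finset ℕ,
            (∀ j ∈ S, ∃ i : Fin m, ∃ s ∈ Set.Ioo 0 T,
                T - s ≤ K * lam ^ (-((4 / 5 : ℝ) * j)) ∧ δ ≤ |critAmp lam X i (j : ℤ) s|) →
            S.card ≤ N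

/-! ## Card `quiet-valve-budget` -/

/-- Critical block energy strictly above scale `n`, in the clock/amplitude units of scale `n+1`:
`ℰ_n(t) = lam^{2(n+1)/5} Σ_{k ≥ 0} Σ_i X_{i,n+1+k}(t)²  (= Σ_k lam^{-2k/5} |a_{n+1+k}|² ≤ m M^{2/3}/(1-lam^{-2/5}))`. -/
def blockEnergy {m : ℕ} (lam : ℝ) (X : Fin m → ℤ → ℝ → ℝ) (n : ℤ) (t : ℝ) : ℝ :=
  lam ^ ((2 / 5 : ℝ) * (n + 1)) * ∑' k : ℕ, ∑ i : Fin m, (X i (n + 1 + k) t) ^ 2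

/-- LEMMA (F): TRIAD FLUX IDENTITY.  Cyclic cancellation conserves energy triad by triad
(`{n,n,n}` and `{n,n,n+1}` are the only triads for offsets in S), so the energy of the block above
`n` changes only by its own dissipation and by the flux through the single triad `{n,n,n+1}`,
which is the `μ = (0,0,1)` ("some 2") interaction: flux `= 2 lam^n Σ coeff(i₁,i₂,i₃,some 2)
X_{i₁,n} X_{i₂,n} X_{i₃,n+1}`, of critical size `lam^{2n/5-1/5}·a_n² a_{n+1}` — QUADRATIC in the
valve amplitude `a_n`. (Termwise differentiation by the a-priori `H¹⁰` bound.) -/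
def TriadFlux : Prop :=
  ∀ lam : ℝ, 1 < lam → ∀ (m : ℕ) (coeff : Fin m → Fin m → Fin m → Option (Fin 3) → ℝ),
    IsSymmCoeff m coeff → IsCyclicCoeff m coeff →
      ∀ (T : ℝ) (X : Fin m → ℤ → ℝ → ℝ), 0 < T → IsCircuitSolution lam m coeff T X →
        ∀ n : ℤ, 0 ≤ n → ∀ t ∈ Set.Ioo 0 T,
          HasDerivAt (fun t => ∑' k : ℕ, ∑ i : Fin m, (X i (n + 1 + k) t) ^ 2)
            (-2 * (∑' k : ℕ, ∑ i : Fin m, lam ^ ((4 / 5 : ℝ) * (n + 1 + k)) * (X i (n + 1 + k) t) ^ 2)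
              + 2 * lam ^ (n : ℝ) * ∑ i₁ : Fin m, ∑ i₂ : Fin m, ∑ i₃ : Fin m,
                  coeff i₁ i₂ i₃ (some 2) * X i₁ n t * X i₂ n t * X i₃ (n + 1) t) t

/-- FIRST LEMMA (V): QUIET-VALVE BUDGET.  If scale `n` is `δ`-quiet on `[t₁,t₂]` while at every
instant some scale above `n` is `δ`-active, the block above `n` loses critical energy at rate
`≥ δ²` per unit of scale-`(n+1)` clock (dissipation of the active scale beats the cubic leakage
through the quiet valve once `δ ≤ δ₀(lam,m,coeff)`), and the block's critical energy is
`≤ C M^{2/3}`; hence the ACTIVE LIFETIME above a quiet valve is bounded in valve-clock units. -/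
def ValveBudget : Prop :=
  ∀ lam : ℝ, 1 < lam → ∀ (m : ℕ) (coeff : Fin m → Fin m → Fin m → Option (Fin 3) → ℝ),
    IsSymmCoeff m coeff → IsCyclicCoeff m coeff →
      ∃ δ₀ C : ℝ, 0 < δ₀ ∧ ∀ δ : ℝ, 0 < δ → δ ≤ δ₀ →
        ∀ (M T : ℝ) (X : Fin m → ℤ → ℝ → ℝ), 0 < T →
          IsCircuitSolution lam m coeff T X → CritL3Bound lam m T M X →
            ∀ n : ℤ, 0 ≤ n → ∀ t₁ t₂ : ℝ, 0 < t₁ → t₁ ≤ t₂ → t₂ < T →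
              (∀ i : Fin m, ∀ t ∈ Set.Icc t₁ t₂, |critAmp lam X i n t| ≤ δ) →
              (∀ t ∈ Set.Icc t₁ t₂, ∃ i : Fin m, ∃ j : ℤ, n < j ∧ δ ≤ |critAmp lam X i j t|) →
              δ ^ 2 * lam ^ ((4 / 5 : ℝ) * (n + 1)) * (t₂ - t₁) ≤ C * M ^ ((2 : ℝ) / 3)

/-- LEMMA (Q): QUIET BLOCK ⇒ REGULAR (two maximum principles).  If the valve scale `n` stays
`δ₁`-quiet on `[t₁,T)` and the block above it is `δ₁`-quiet at `t₁`, the block stays quiet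
(sup-norm maximum principle with boundary forcing `O(δ₁²)`), the weighted amplitudes
`lam^{4j}|X_{i,j}|` of the block obey a maximum principle too (small critical amplitude is
self-improving under the dissipation; `δ₁ = δ₁(lam,m,coeff)`), and the finitely many scales `≤ n`
are bounded by `M^{1/3} lam^{-j/5}`: the crux's conclusion follows. -/
def QuietBlockRegular : Prop :=
  ∀ lam : ℝ, 1 < lam → ∀ (m : ℕ) (coeff : Fin m → Fin m → Fin m → Option (Fin 3) → ℝ),
    ∃ δ₁ : ℝ, 0 < δ₁ ∧ ∀ (M T : ℝ) (X : Fin m → ℤ → ℝ → ℝ), 0 < T →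
      IsCircuitSolution lam m coeff T X → CritL3Bound lam m T M X →
        ∀ n : ℤ, 0 ≤ n → ∀ t₁ ∈ Set.Ioo 0 T,
          (∀ i : Fin m, ∀ t ∈ Set.Ico t₁ T, |critAmp lam X i n t| ≤ δ₁) →
          (∀ i : Fin m, ∀ j : ℤ, n < j → |critAmp lam X i j t₁| ≤ δ₁) →
          ∃ C : ℝ, ∀ (i : Fin m) (j : ℤ), ∀ t ∈ Set.Ico 0 T, lam ^ ((4 : ℝ) * j) * |X i j t| ≤ C

/-! ## Intended composition (for crux-plan; elementary logic + the choice of `K` and `n`)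

Given the crux hypotheses with bound `M`: put `δ := min δ₀ δ₁`, `K := (C M^{2/3} / (δ² lam^{4/5})) + 1`;
`LateActivitySparse` gives a finite set of "late-active" scales; take `n` above all of them with
`K lam^{-4n/5} < T`; scale `n` is then `δ`-quiet on the final window `W = [T - K lam^{-4n/5}, T)`.
Either the block above `n` is quiet at some `t₁ ∈ W` — then `QuietBlockRegular` concludes — or it is
active at every instant of `W`, and `ValveBudget` on `[t₁', t₂] ⊂ W` with `t₁' ↓ inf W`, `t₂ ↑ T`
gives `δ² lam^{4/5} K ≤ C M^{2/3}`, contradicting the choice of `K`. -/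
def LineCloses : Prop :=
  LateActivitySparse → ValveBudget → QuietBlockRegular →
    Summit.NavierStokesRegularity.NavierStokesRegularity.Theses.PerpetualPump.CircuitTrace

end Summit.NavierStokesRegularity.NavierStokesRegularity.Cruxes.CircuitTrace.Ideator3

end
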